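import Literature.Geometry.Riemannian.GurskyViaclovskyBackgroundNaturality
import Literature.Geometry.Lorentzian.InitialDataPullback
import HarnessLib

/-!
# Gursky–Viaclovsky closedness: naturality of the covariant bounds under equidimensional
# immersions (transport of the fact's hypotheses to the chart metric)

Support file (everything PROVED; no definition, no named fact) for the named fact
`Literature.Geometry.Riemannian.gurskyViaclovsky_pathClosed_weighted_four`. The hypotheses of
the fact (and of `uniformlyElliptic_along_solution` / `symbol_uniformlyElliptic_along_solution`)
are covariant scalars — `|∇u|²_g`, `|∇²u|²_g`, `|Ric_g|²`, `R_g`, the background equation and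
the admissibility — so they transport verbatim to the pulled-back metric `Φ^*g` on an open
subset of `ℝ⁴` (the preferred chart). This file proves, for an equidimensional immersion
`Φ : N → M` of `4`-manifolds and a Riemannian `g`:

* `gradSq_comap` — `|∇(w ∘ Φ)|²_{Φ^*g}(y) = |∇w|²_g(Φ y)`;
* `normSq_hessian_comap` — `|∇²(w ∘ Φ)|²_{Φ^*g}(y) = |∇²w|²_g(Φ y)`;
* `normSq_ricci_comap` — `|Ric_{Φ^*g}|²(y) = |Ric_g|²(Φ y)`;

(the scalar curvature, the background scalar and the background operator are
`scalarCurvature_comap_cn`, `backgroundScalar_comap`, `backgroundPathOperator_comap`).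

## References

* B. O'Neill, *Semi-Riemannian Geometry* (1983), Ch. 3, pp. 90–91, Prop. 3.59. [ONeill1983]
* M. J. Gursky, J. A. Viaclovsky, J. Differential Geom. 63 (2003) 131–154, Prop. 6.
  [GurskyViaclovsky2003]
-/

noncomputable section

open scoped Manifold ContDiff Topology
open Set Function Module Finset

namespace Literature.Geometry.Riemannian.GurskyViaclovskyPath

open Literature.Geometry.Lorentzian (PseudoRiemannianMetric)
open Literature.Geometry.Lorentzian.PseudoRiemannianMetric
open Literature.Geometry.Lorentzian

section Naturality

variable {M : Type*} [TopologicalSpace M] [ChartedSpace (EuclideanSpace ℝ (Fin 4)) M]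
  [IsManifold (𝓡 4) ∞ M]
  {N : Type*} [TopologicalSpace N] [ChartedSpace (EuclideanSpace ℝ (Fin 4)) N]
  [IsManifold (𝓡 4) ∞ N]
  (g : PseudoRiemannianMetric (𝓡 4) ∞ (EuclideanSpace ℝ (Fin 4)) (TangentSpace (𝓡 4) : M → Type _))
  [g.HasLeviCivita]
  {Φ : N → M} (hpb : contMDiff_pullbackBilin (𝓡 4) M (𝓡 4) N ∞)
  (hΦ : ContMDiff (𝓡 4) (𝓡 4) (∞ + 1) Φ)
  (hΦ' : ∀ y, Function.Injective (mfderiv (𝓡 4) (𝓡 4) Φ y))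
  (hdim : finrank ℝ (EuclideanSpace ℝ (Fin 4)) = finrank ℝ (EuclideanSpace ℝ (Fin 4)))
  [(g.comap hpb Φ hΦ hΦ' hdim).HasLeviCivita]

omit [g.HasLeviCivita] [(g.comap hpb Φ hΦ hΦ' hdim).HasLeviCivita] in
/-- **The gradient square is natural**: `|∇(w ∘ Φ)|²_{Φ^*g}(y) = |∇w|²_g(Φ y)` (both are sums of
squares of frame derivatives in corresponding orthonormal frames, `dΦ e_a = b_a`).
[cite: ONeill1983, Ch. 3, pp. 90–91] -/
theorem gradSq_comap (hg : g.IsRiemannian) {w : M → ℝ}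
    (hw : ContMDiff (𝓡 4) 𝓘(ℝ) ∞ w) (y : N) :
    (g.comap hpb Φ hΦ hΦ' hdim).gradSq (w ∘ Φ) y = g.gradSq w (Φ y) := by
  have hE : finrank ℝ (EuclideanSpace ℝ (Fin 4)) = 4 := finrank_euclideanSpace_fin
  have hn : (2 : ℕ∞ω) ≤ ((⊤ : ℕ∞) : ℕ∞ω) := WithTop.coe_le_coe.mpr le_top
  have hinv := isInvertible_mfderiv_of_injective (Φ := Φ) hdim (hΦ' y)
  obtain ⟨b, hb⟩ := g.exists_basis_isOrthonormalFrame (x := Φ y) (fun v hv ↦ hg _ v hv) hE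
  set e : Fin 4 → TangentSpace (𝓡 4) y := fun i ↦ (mfderiv (𝓡 4) (𝓡 4) Φ y).inverse (b i)
    with he_def
  have hde : ∀ i, mfderiv (𝓡 4) (𝓡 4) Φ y (e i) = b i := fun i ↦ hinv.self_apply_inverse (b i)
  have he : (g.comap hpb Φ hΦ hΦ' hdim).IsOrthonormalFrame y e := by
    rw [g.isOrthonormalFrame_comap_iff hpb hΦ hΦ' hdim]
    simp only [hde]
    exact hb
  have hw2 : ContMDiffAt (𝓡 4) 𝓘(ℝ) 2 w (Φ y) := (hw.of_le hn) _
  have hwd : MDifferentiableAt (𝓡 4) 𝓘(ℝ, ℝ) w (Φ y) := hw2.mdifferentiableAt (by simp)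
  have hΦd : MDifferentiableAt (𝓡 4) (𝓡 4) Φ y :=
    ((hΦ.of_le le_self_add) y).mdifferentiableAt (by simp)
  have hd : ∀ a, mvfderiv (𝓡 4) (w ∘ Φ) y (e a) = mvfderiv (𝓡 4) w (Φ y) (b a) := fun a ↦ by
    rw [mvfderiv_comp_apply hwd hΦd, hde]
  rw [gradSq_eq_sum_orthonormalFrame _ (w ∘ Φ) he, gradSq_eq_sum_orthonormalFrame g w hb]
  simp only [hd]

/-- **The square norm of the covariant Hessian is natural**:
`|∇²(w ∘ Φ)|²_{Φ^*g}(y) = |∇²w|²_g(Φ y)` (`Hess^{Φ^*g}(w∘Φ) = Hess^g w ∘ (dΦ × dΦ)`,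
`hessian_comap_apply`, and the square norm is natural, `normSq_comap`).
[cite: ONeill1983, Ch. 3, Prop. 3.59] -/
theorem normSq_hessian_comap {w : M → ℝ} (hw : ContMDiff (𝓡 4) 𝓘(ℝ) ∞ w) (y : N) :
    (g.comap hpb Φ hΦ hΦ' hdim).normSq y ((g.comap hpb Φ hΦ hΦ' hdim).hessian (w ∘ Φ) y) =
      g.normSq (Φ y) (g.hessian w (Φ y)) := by
  have hn : (2 : ℕ∞ω) ≤ ((⊤ : ℕ∞) : ℕ∞ω) := WithTop.coe_le_coe.mpr le_top
  have hw2 : ContMDiffAt (𝓡 4) 𝓘(ℝ) 2 w (Φ y) := (hw.of_le hn) _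
  set eq := mfderivEquivOfInjective (I := 𝓡 4) (I' := 𝓡 4) Φ y (hΦ' y) hdim with heq
  have hB : (g.comap hpb Φ hΦ hΦ' hdim).hessian (w ∘ Φ) y =
      (g.hessian w (Φ y)).comp eq.toLinearMap eq.toLinearMap := by
    refine LinearMap.ext fun v ↦ LinearMap.ext fun v' ↦ ?_
    rw [g.hessian_comap_apply hpb hΦ hΦ' hdim hw2 v v']
    rfl
  rw [hB]
  exact g.normSq_comap hpb hΦ hΦ' hdim y (g.hessian w (Φ y))

/-- **The square norm of the Ricci tensor is natural**: `|Ric_{Φ^*g}|²(y) = |Ric_g|²(Φ y)`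
(`Ric_{Φ^*g} = Ric_g ∘ (dΦ × dΦ)`, `ricci_comap_apply_cn`, and `normSq_comap`).
[cite: ONeill1983, Ch. 3, pp. 90–91] -/
theorem normSq_ricci_comap (y : N) :
    (g.comap hpb Φ hΦ hΦ' hdim).normSq y ((g.comap hpb Φ hΦ hΦ' hdim).ricci y) =
      g.normSq (Φ y) (g.ricci (Φ y)) := by
  have hn : (2 : ℕ∞ω) ≤ ((⊤ : ℕ∞) : ℕ∞ω) := WithTop.coe_le_coe.mpr le_top
  set eq := mfderivEquivOfInjective (I := 𝓡 4) (I' := 𝓡 4) Φ y (hΦ' y) hdim with heq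
  have hB : (g.comap hpb Φ hΦ hΦ' hdim).ricci y =
      (g.ricci (Φ y)).comp eq.toLinearMap eq.toLinearMap := by
    refine LinearMap.ext fun v ↦ LinearMap.ext fun v' ↦ ?_
    rw [g.ricci_comap_apply_cn hpb hΦ hΦ' hdim hn y v v']
    rfl
  rw [hB]
  exact g.normSq_comap hpb hΦ hΦ' hdim y (g.ricci (Φ y))

end Naturality

end Literature.Geometry.Riemannian.GurskyViaclovskyPath

end
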